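import Summits.QuantumAdvantage.AdviceFreeQNC0.ProductGame
import HarnessLib

/-!
# Cell qa-qnc0 — `stub_product`: weighted residue avoidance + elimination hardness give the product game

The stub `stub_product : LDMAPolylog → ElimHard → ProductHardPolylog` of planner qa-qnc0-p1's line
`product` of the route crux `RingToElim`, PROVED for all block lengths with the three bodies
verbatim (`productHard_of_ldma_of_elimHard`; TARGET §17.1 + §17.4):

1. (triple normal form) re-stake every column of Alice's `X` to class `0` (`isElimWin_class0`);
   then `X u v = g_{x(u)}(u, v)` for the zero-sum triple `(g₀, g₁, g₂) = (b_v, a_v, a_v ⊕ b_v)`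
   and the residue label `x(u) = (−|u|) mod 3` (`win_eq_triple`);
2. (row decomposition) in row `u`, Bob's complement `¬Y(u,·)` is a fail pattern `F_u`, and the
   agreements of the row are `dist(g_{x(u)}(u,·), F_u) ≥ distFail D (g_{x(u)}(u,·))`;
3. (LDMA, per `r`) `Σ_{x(u) = r} distFail(g_r(u,·)) ≥ κ Σ_u distFail(g_r(u,·))`;
4. (potential costs, `potential_cost`) `Σ_r distFail(g_r(u,·)) ≥ w = distFail D 0`;
5. (`ElimHard`, `le_distFail_zero`) `w ≥ η₀ 2^{L'}`; so `agree ≥ κ η₀ 2^{L+L'}`, `μ = κ η₀`.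
-/

namespace Summit.QuantumAdvantage.AdviceFreeQNC0

open Finset Literature.Computability.MetaComplexity Literature.Computability.MetaComplexity.Smolensky

variable {L L' : ℕ}

/-! ### Alice's triple normal form -/

/-- The residue label `x(u) = (−|u|) mod 3` of a row. -/
def resLabel (u : Fin L → Bool) : Fin 3 := ⟨(3 - wt u % 3) % 3, Nat.mod_lt _ (by norm_num)⟩

/-- The zero-sum triple `(g₀, g₁, g₂) = (β, α, α ⊕ β)` read at label `r`. -/
def triple (r : Fin 3) (α β : Bool) : Bool :=
  if r.val = 0 then β else if r.val = 1 then α else xor α β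

/-- The triple sums to zero. -/
theorem triple_sum (α β : Bool) : xor (xor (triple 0 α β) (triple 1 α β)) (triple 2 α β) = false := by
  cases α <;> cases β <;> decide

/-- The win bit of class-`0` stakes on residues (finite check). -/
private theorem win_law : ∀ t : Fin 3, ∀ α β : Bool,
    (!elimFailBits 0 α β t.val) =
      (if (3 - t.val) % 3 = 0 then β else if (3 - t.val) % 3 = 1 then α else xor α β) := by
  decide

/-- **Class-`0` stakes `(α, β)` WIN at `u` iff `g_{x(u)} = 1`** for the triple `(β, α, α ⊕ β)`. -/
theorem win_eq_triple (α β : Bool) (u : Fin L → Bool) :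
    (!elimFailBits 0 α β (wt u)) = triple (resLabel u) α β := by
  unfold triple resLabel
  rw [elimFailBits_mod, Nat.zero_mod]
  exact win_law ⟨wt u % 3, Nat.mod_lt _ (by norm_num)⟩ α β

/-! ### Fiberwise counting -/

/-- Cells of a product set counted row by row. -/
theorem card_filter_prod_eq_sum {α β : Type*} [Fintype α] [Fintype β] (P : α → β → Prop)
    [∀ a b, Decidable (P a b)] :
    (univ.filter fun p : α × β => P p.1 p.2).card = ∑ a, (univ.filter fun b => P a b).card := by
  rw [card_filter, ← Finset.univ_product_univ, Finset.sum_product]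
  refine Finset.sum_congr rfl fun a _ => ?_
  rw [card_filter]

/-! ### The stub -/

/-- **`stub_product`, all `L, L'`** (bodies of `LDMAPolylog`, `ElimHard`, `ProductHardPolylog`
verbatim): weighted residue non-avoidance for low-degree maps and elimination hardness imply that
the product game loses a `κη₀`-fraction of the cells. -/
theorem productHard_of_ldma_of_elimHard
    (hL : ∃ κ : ℝ, 0 < κ ∧ ∀ C : ℕ, ∃ L₀ : ℕ, ∀ L L' : ℕ, L₀ ≤ L → L₀ ≤ L' → ∀ D : ℕ,
      D ≤ (Nat.log 2 (min L L')) ^ C →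
        ∀ Γ : (Fin L → Bool) → (Fin L' → Bool) → Bool, (∀ v, HasDeg (fun u => Γ u v) D) → ∀ r : ℕ,
          κ * ((∑ u : Fin L → Bool, distFail D (Γ u) : ℕ) : ℝ) ≤
            ((∑ u ∈ univ.filter (fun u : Fin L → Bool => wt u % 3 = r % 3), distFail D (Γ u) : ℕ) : ℝ))
    (hE : ∃ η₀ : ℝ, 0 < η₀ ∧ ∀ C : ℕ, ∃ n₀ : ℕ, ∀ n ≥ n₀, ∀ a b : CubeFn (ZMod 2) n,
      a ∈ lowDeg (ZMod 2) n ((Nat.log 2 n) ^ C) → b ∈ lowDeg (ZMod 2) n ((Nat.log 2 n) ^ C) →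
        ∀ dec : ZMod 2 → ZMod 2 → ℕ,
          η₀ * (2 : ℝ) ^ n ≤ ((univ.filter fun u : Fin n → Bool =>
            dec (a u) (b u) % 3 = Hegedus.wt u % 3).card : ℝ)) :
    ∃ μ : ℝ, 0 < μ ∧ ∀ C : ℕ, ∃ L₀ : ℕ, ∀ L L' : ℕ, L₀ ≤ L → L₀ ≤ L' →
      ∀ X Y : (Fin L → Bool) → (Fin L' → Bool) → Bool,
        (∀ v, IsElimWin ((Nat.log 2 (min L L')) ^ C) (fun u => X u v)) →
        (∀ u, IsElimWin ((Nat.log 2 (min L L')) ^ C) (fun v => Y u v)) →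
          μ * (2 : ℝ) ^ (L + L') ≤ (agreeCountR X Y : ℝ) := by
  obtain ⟨κ, hκ, hLD⟩ := hL
  obtain ⟨η₀, hη₀, hEl⟩ := hE
  refine ⟨κ * η₀, mul_pos hκ hη₀, fun C => ?_⟩
  obtain ⟨L₁, hL₁⟩ := hLD C
  obtain ⟨n₀, hn₀⟩ := hEl C
  refine ⟨max L₁ n₀, fun L L' hL hL' X Y hX hY => ?_⟩
  set D := (Nat.log 2 (min L L')) ^ C with hD
  -- Alice's class-0 stakes, column by column
  have hXc : ∀ v, ∃ ab : ((Fin L → Bool) → Bool) × ((Fin L → Bool) → Bool),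
      HasDeg ab.1 D ∧ HasDeg ab.2 D ∧ ∀ u, X u v = !(elimFail 0 ab.1 ab.2 u) := fun v => by
    obtain ⟨a, b, ha, hb, h⟩ := isElimWin_class0 (hX v)
    exact ⟨(a, b), ha, hb, h⟩
  choose ab hab using hXc
  -- the zero-sum triple as maps `Γ r : u ↦ g_r(u, ·)`
  set Γ : Fin 3 → (Fin L → Bool) → (Fin L' → Bool) → Bool :=
    fun r u v => triple r ((ab v).1 u) ((ab v).2 u) with hΓ
  have hΓdeg : ∀ r v, HasDeg (fun u => Γ r u v) D := by
    intro r v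
    simp only [hΓ, triple]
    split_ifs
    · exact (hab v).2.1
    · exact (hab v).1
    · exact hasDeg_xor (hab v).1 (hab v).2.1
  have hXΓ : ∀ u v, X u v = Γ (resLabel u) u v := fun u v => by
    rw [(hab v).2.2 u]
    unfold elimFail
    rw [win_eq_triple]
  -- Bob's fail pattern in row `u`
  have hYf : ∀ u, IsElimFail D (fun v => !(Y u v)) := by
    intro u
    obtain ⟨c, a, b, ha, hb, h⟩ := hY u
    refine ⟨c, a, b, ha, hb, fun v => ?_⟩
    have hv : Y u v = !elimFail c a b v := h v
    show (!Y u v) = elimFail c a b v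
    rw [hv, Bool.not_not]
  -- row decomposition
  have hrow : ∀ u, distFail D (Γ (resLabel u) u) ≤ (univ.filter fun v => X u v = Y u v).card := by
    intro u
    refine le_trans (distFail_le _ (hYf u)) (le_of_eq ?_)
    unfold hdist
    congr 1
    ext v
    simp only [mem_filter, mem_univ, true_and, hXΓ u v]
    cases Γ (resLabel u) u v <;> cases Y u v <;> decide
  have hagree : agreeCountR X Y = ∑ u, (univ.filter fun v => X u v = Y u v).card := by
    unfold agreeCountR
    exact card_filter_prod_eq_sum (fun u v => X u v = Y u v)
  -- LDMA, one residue at a time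
  have hLr : ∀ r : Fin 3, κ * ∑ u : Fin L → Bool, (distFail D (Γ r u) : ℝ) ≤
      ∑ u ∈ univ.filter (fun u => resLabel u = r), (distFail D (Γ r u) : ℝ) := by
    intro r
    have h := hL₁ L L' (le_trans (le_max_left _ _) hL) (le_trans (le_max_left _ _) hL') D le_rfl
      (Γ r) (fun v => hΓdeg r v) ((3 - r.val) % 3)
    have hset : (univ.filter fun u : Fin L → Bool => wt u % 3 = ((3 - r.val) % 3) % 3) =
        univ.filter fun u => resLabel u = r := by
      ext u
      simp only [mem_filter, mem_univ, true_and, resLabel, Fin.ext_iff]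
      have := r.isLt
      omega
    rw [hset] at h
    push_cast at h
    exact h
  -- potential costs and the minimum fail weight
  have hpc : ∀ u : Fin L → Bool, (distFail D (fun _ : Fin L' → Bool => false) : ℝ) ≤
      (distFail D (Γ 0 u) : ℝ) + distFail D (Γ 1 u) + distFail D (Γ 2 u) := fun u => by
    exact_mod_cast potential_cost D _ _ _ fun v => triple_sum ((ab v).1 u) ((ab v).2 u)
  have hw : η₀ * (2 : ℝ) ^ L' ≤ (distFail D (fun _ : Fin L' → Bool => false) : ℝ) :=
    le_distFail_zero hn₀ (le_trans (le_max_right _ _) hL')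
      (Nat.pow_le_pow_left (Nat.log_mono_right (min_le_right L L')) C)
  -- assembling the chain
  have h1 : (∑ u : Fin L → Bool, (distFail D (Γ (resLabel u) u) : ℝ)) ≤ (agreeCountR X Y : ℝ) := by
    rw [hagree]
    push_cast
    exact Finset.sum_le_sum fun u _ => by exact_mod_cast hrow u
  have h2 : (∑ u : Fin L → Bool, (distFail D (Γ (resLabel u) u) : ℝ)) =
      ∑ r : Fin 3, ∑ u ∈ univ.filter (fun u => resLabel u = r), (distFail D (Γ r u) : ℝ) := by
    rw [← Finset.sum_fiberwise_of_maps_to (s := (univ : Finset (Fin L → Bool))) (t := (univ : Finset (Fin 3)))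
      (g := resLabel) (fun u _ => mem_univ _) (f := fun u => (distFail D (Γ (resLabel u) u) : ℝ))]
    refine Finset.sum_congr rfl fun r _ => Finset.sum_congr rfl fun u hu => ?_
    rw [(Finset.mem_filter.1 hu).2]
  have h4 : ∑ r : Fin 3, ∑ u : Fin L → Bool, (distFail D (Γ r u) : ℝ) =
      ∑ u : Fin L → Bool, ((distFail D (Γ 0 u) : ℝ) + distFail D (Γ 1 u) + distFail D (Γ 2 u)) := by
    rw [Finset.sum_comm]
    refine Finset.sum_congr rfl fun u _ => ?_
    rw [Fin.sum_univ_three]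
  have hcard : (∑ _u : Fin L → Bool, (distFail D (fun _ : Fin L' → Bool => false) : ℝ)) =
      (2 : ℝ) ^ L * (distFail D (fun _ : Fin L' → Bool => false) : ℝ) := by
    rw [Finset.sum_const, card_univ, Fintype.card_fun, Fintype.card_bool, Fintype.card_fin,
      nsmul_eq_mul]
    push_cast
    ring
  calc κ * η₀ * (2 : ℝ) ^ (L + L')
      = κ * ((2 : ℝ) ^ L * (η₀ * (2 : ℝ) ^ L')) := by rw [pow_add]; ring
    _ ≤ κ * ((2 : ℝ) ^ L * (distFail D (fun _ : Fin L' → Bool => false) : ℝ)) := by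
        have h2L : (0 : ℝ) ≤ (2 : ℝ) ^ L := by positivity
        exact mul_le_mul_of_nonneg_left (mul_le_mul_of_nonneg_left hw h2L) hκ.le
    _ = κ * ∑ _u : Fin L → Bool, (distFail D (fun _ : Fin L' → Bool => false) : ℝ) := by rw [hcard]
    _ ≤ κ * ∑ u : Fin L → Bool, ((distFail D (Γ 0 u) : ℝ) + distFail D (Γ 1 u) + distFail D (Γ 2 u)) :=
        mul_le_mul_of_nonneg_left (Finset.sum_le_sum fun u _ => hpc u) hκ.le
    _ = ∑ r : Fin 3, κ * ∑ u : Fin L → Bool, (distFail D (Γ r u) : ℝ) := by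
        rw [← h4, Finset.mul_sum]
    _ ≤ ∑ r : Fin 3, ∑ u ∈ univ.filter (fun u => resLabel u = r), (distFail D (Γ r u) : ℝ) :=
        Finset.sum_le_sum fun r _ => hLr r
    _ = ∑ u : Fin L → Bool, (distFail D (Γ (resLabel u) u) : ℝ) := h2.symm
    _ ≤ (agreeCountR X Y : ℝ) := h1

end Summit.QuantumAdvantage.AdviceFreeQNC0
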